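import Literature.NumberTheory.Automorphic.TorusOrbitalDescentUnitCanonical
import Literature.NumberTheory.Automorphic.RegularDiagonalCentralizer
import Literature.NumberTheory.Automorphic.UnitaryGroupTorusOrbitalDescentNonsplit
import Literature.NumberTheory.Automorphic.UnitaryGroupHeisenbergRingRegularTwist
import Literature.NumberTheory.Automorphic.LocalUnitaryIntegralLevel
import Literature.NumberTheory.Automorphic.CompactCoreCentralizerLevelOfIntegralConjugacy
import Literature.NumberTheory.Automorphic.OrbitalMeasureCanonicalAtPoint
import Literature.NumberTheory.Automorphic.OrbitalMeasureCanonicalExistsCM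
import Literature.NumberTheory.Automorphic.OrbitalIntegralKConjugacyClasses
import Literature.NumberTheory.Automorphic.UnitaryResiduallyRegularOrbitalIntegral
import Literature.NumberTheory.Automorphic.UnramifiedOrbitSetAdelic
import Literature.NumberTheory.Automorphic.UnitaryGroupOrbitalMeasureOfLocalQuotient
import Literature.MeasureTheory.Group.InvariantQuotientNormalized
import HarnessLib

/-!
# The unit orbital integral of the inner form `U(H′)(L⁺_v)` at a SPLIT-TORUS class, at a non-split place of good reduction:
# `Φ(⟦γ₀⟧, 1_{K′}) = (‖d₀⁻¹d₁ − 1‖ · χ⁻(d₀⁻¹d₂ − 1))⁻¹`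
(Rogawski (1990), §4.9 Prop. 4.9.1 (b) and (4.9.2) p. 55 «`Φ(γ, 1_K) = |D(γ)|⁻¹(1_K)^{(B)}(γ)`», the Levi ∕ constant-term case of the unit
fundamental lemma; §4.3 (4.3.1) p. 43 compatible measures; §14.2 p. 233 «`K_v ≃ K′_v`»; Deitmar–Echterhoff (2014) Thm. 1.5.3)

Topic `NumberTheory/Automorphic`; namespace `Literature.NumberTheory.Automorphic.UnitaryGroup`.  KERNEL mathematics only: theorems, no
definition, no named fact, no instance, no `sorry`.  Cell `pub/hodgecm-mathlib`, programme P3a, road «D-N7-inert» (map v2 f057cb56 §1 row L8 (P2)),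
brick «JUNCTION-Levi» FILE C2 = the `G`-SIDE VALUE (LEAD F0P3a-plan (g9) T8-20 (D)(1); cut-holder F0P3b-p01 (g6)).  HONEST LABEL: HC_CM is proved
only modulo the 2 remaining named inputs (hLiu418, h413) until rung 0 closes; this file discharges no named fact.

THE ASSEMBLY (every input ★): at a finite place `v` of `L⁺` NON-SPLIT and unramified in `L`, of good reduction for the hermitian `H′`
(`H′_w ∈ GL₃(𝒪_w)`), let `t = diag(d) ∈ T(𝒪_v) ≤ U(Φ₃)(L⁺_v)` be REGULAR (`dᵢ − dⱼ` units of `∏_{w∣v} L_w`).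
* `exists_continuousMulEquiv_level_isConj_of_nonsplit` — Jacobowitz's `H′_w = ᵗσT·Φ₃·T` (★ `exists_glInt_placeForm_eq_formCongr_antidiagonal_of_isUnramifiedIn`)
  gives `ψ : U(H′)(L⁺_v) ≃ₜ* U(Φ₃)(L⁺_v)` (★ `localNonsplitCongr`) with `ψ(K′) = K₃` and `ψ g ∼ g` in `GL₃(∏ L_w)` (so matching and regularity transport).
* **`exists_classOrbitalIntegral_indicator_eq_twist_of_torus_regular_of_nonsplit`** — for a CANONICAL family `mG` on `U(H′)(L⁺_v)` (★ `IsCanonical` at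
  `IsRegularElt`, Haar `νG(K′) = 1`): `γ₀ := ψ⁻¹ t ∈ K′` is `GL₃`-conjugate to `t` and
  `classOrbitalIntegral mG 1_{K′} ⟦γ₀⟧ = J_G(d) := (‖d₀⁻¹d₁ − 1‖_{∏L_w} · χ⁻(d₀⁻¹d₂ − 1))⁻¹` — ★ A-p12's twist module (`lintegral_conj_cmBorel_eq_mul_lintegral_mul`).
  Chain: ★ `IsCanonical.classOrbitalIntegral_mk_eq_orbitalIntegral'` (canonical member `νG ∕ t_Z`, `t_Z(compactCore Z(γ₀)) = 1`, ★
  `forall_isRegularElt_exists_isHaarMeasure_compactCore_centralizer_local_eq_one`) → ★ `orbitalIntegral_indicator_complex_eq_ofReal` ∕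
  `orbitalIntegral_indicator_eq_toReal_lintegral` → ★ FILE B `lintegral_descConj_centralizer_indicator_eq_of_mulEquiv` along `ψ` with `T = torusU`
  (`Ψ Z(γ₀) = T`: ★ FILE C1 `mem_torusU_iff_mem_centralizer_of_isUnit_sub`; `ν = ψ_*νG`, `ν(K₃) = 1`; `t_T = ψ_*t_Z`, `t_T(T ∩ K₃) = 1` from
  `compactCore Z(γ₀) ⊆ K′` by ★ `compactCore_centralizer_subset_of_hom` + ★ FILE C1 `subgroup_le_glInt_of_isCompact_of_le_centralizer_diagonal` at the
  regular diagonal `w`-component `diag(d_w)`; Iwasawa form ★ B-p12 `exists_measure_quotient_torusU_cmLocal_eq_smul_map`; good position ★ A-p06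
  `mem_cmLocalIntegralLevel_of_torus_mul_unipotent`; `T` normalises `N` ★ `conj_mem_unipotentU_cmLocal`).
NOT here: the `H`-side value, `Δ‴_v` on the stratum, the letter clause (sequel files of the junction).

## References
* [Rogawski1990] J. D. Rogawski, *Automorphic Representations of Unitary Groups in Three Variables*, Ann. of Math. Stud. 123 (1990), §4.9 Prop. 4.9.1 (b),
  (4.9.2) p. 55; §4.3 (4.3.1) p. 43; §14.2 p. 233; §3.1 p. 19.
* [DeitmarEchterhoff2014] A. Deitmar, S. Echterhoff, *Principles of Harmonic Analysis*, 2nd ed. (2014), Thm. 1.5.3.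
* [Jacobowitz1962] R. Jacobowitz, *Hermitian forms over local fields*, Amer. J. Math. 84 (1962), §7 Thm. 7.1.
-/

set_option autoImplicit false

noncomputable section

open MeasureTheory Measure Set Filter Topology NumberField IsDedekindDomain
open Literature.MeasureTheory.Group
open scoped ENNReal NNReal Matrix MatrixGroups

namespace Literature.NumberTheory.Automorphic.UnitaryGroup

open Literature.NumberTheory.Rogawski1990 (IsRegularElt isRegularElt_iff isRegularElt_of_isConj)
open Literature.NumberTheory.Automorphic

/-- `IsConj` descends along a multiplicative equivalence. [cite: Rogawski1990, §3.1 p. 19] -/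
private theorem isConj_of_isConj_mulEquiv' {G G' : Type*} [Monoid G] [Monoid G'] (e : G ≃* G') {a b : G}
    (h : IsConj (e a) (e b)) : IsConj a b := by
  have h' := MonoidHom.map_isConj e.symm.toMonoidHom h
  simpa using h'

/-- **THE LEVEL-PRESERVING COMPARISON `ψ : U(H′)(L⁺_v) ≃ U(Φ₃)(L⁺_v)` at a good non-split place, WITH its conjugacy datum** (Jacobowitz
`H′_w = ᵗσT·Φ₃·T`, `T ∈ GL₃(𝒪_w)`, ★ `exists_glInt_placeForm_eq_formCongr_antidiagonal_of_isUnramifiedIn`; `ψ` = ★ `localNonsplitCongr`,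
`(ψ g)_w = T g_w T⁻¹`): `ψ` preserves the hyperspecial levels, and `ψ g` is `GL₃(∏_{w′∣v} L_{w′})`-conjugate to `g` (so that matching
relations and regularity transport). [cite: Rogawski1990, §14.2 p. 233] [cite: Jacobowitz1962, §7 Thm. 7.1] -/
theorem exists_continuousMulEquiv_level_isConj_of_nonsplit (L : Type) [Field L] [NumberField L] [IsCMField L]
    (H' : Matrix (Fin 3) (Fin 3) L) (hH' : (H'.map (IsCMField.complexConj L))ᵀ = H')
    {v : HeightOneSpectrum (𝓞 ↥(maximalRealSubfield L))} (w : PlacesOver L v) (hw : IsCMField.complexConj L • w.1 = w.1)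
    (hv : Algebra.IsUnramifiedIn (𝓞 L) v.asIdeal) (hH'w : IsUnit (placeForm H' w.1)) (hH'i : hH'w.unit ∈ glInt 3 (w.1.adicCompletion L)) :
    ∃ ψ : (cmDatum L 3 H').Local v ≃ₜ* ↥(unitaryGroupOfForm (conjLocal L (IsCMField.complexConj L) v) (cmLocalForm L 3 v)),
      (∀ g, ψ g ∈ cmLocalIntegralLevel L 3 (Matrix.of fun i j : Fin 3 => if i.val + j.val + 1 = 3 then (1 : L) else 0) v ↔
          g ∈ cmLocalIntegralLevel L 3 H' v) ∧
      (∀ g, IsConj ((g.val : GL (Fin 3) (LocalRing L v)))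
          (((ψ g : ↥(unitaryGroupOfForm (conjLocal L (IsCMField.complexConj L) v) (cmLocalForm L 3 v))) : GL (Fin 3) (LocalRing L v)))) ∧
      ∃ T : GL (Fin 3) (w.1.adicCompletion L), T ∈ glInt 3 (w.1.adicCompletion L) ∧ ∀ g,
        ((localNonsplitEquiv (IsCMField.complexConj L) (Matrix.of fun i j : Fin 3 => if i.val + j.val + 1 = 3 then (1 : L) else 0)
            (IsCMField.complexConj_ne_one L) w hw (ψ g) :
            unitaryGroupOfForm (galAdicCompletionMap (L := L) (IsCMField.complexConj L) hw)
              (placeForm (Matrix.of fun i j : Fin 3 => if i.val + j.val + 1 = 3 then (1 : L) else 0) w.1)) :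
            GL (Fin 3) (w.1.adicCompletion L)) =
          T * ((localNonsplitEquiv (IsCMField.complexConj L) H' (IsCMField.complexConj_ne_one L) w hw g :
            unitaryGroupOfForm (galAdicCompletionMap (L := L) (IsCMField.complexConj L) hw) (placeForm H' w.1)) :
            GL (Fin 3) (w.1.adicCompletion L)) * T⁻¹ := by
  have hc := IsCMField.complexConj_ne_one L
  haveI : Algebra.IsQuadraticExtension ↥(maximalRealSubfield L) L := IsCMField.isQuadraticExtension L
  obtain ⟨T, hT, hJT⟩ := exists_glInt_placeForm_eq_formCongr_antidiagonal_of_isUnramifiedIn ↥(maximalRealSubfield L) L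
    (IsCMField.complexConj L) hc 3 H' hH' v w hw hv hH'w hH'i
  have h : formCongr (galAdicCompletionMap (L := L) (IsCMField.complexConj L) hw) T
      (placeForm (Matrix.of fun i j : Fin 3 => if i.val + j.val + 1 = 3 then (1 : L) else 0) w.1) =
        (1 : w.1.adicCompletion L) • placeForm H' w.1 := by
    rw [one_smul, placeForm_antidiagOne, ← hJT]
  refine ⟨localNonsplitCongr (IsCMField.complexConj L) hc w hw T isUnit_one h, fun g => ?_, fun g => ?_, T, hT, fun g =>
    localNonsplitEquiv_localNonsplitCongr (IsCMField.complexConj L) hc w hw T isUnit_one h g⟩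
  · -- level preservation
    have e1 := mem_localIntegralLevel_iff_of_smul_eq (IsCMField.complexConj L) 3
      (Matrix.of fun i j : Fin 3 => if i.val + j.val + 1 = 3 then (1 : L) else 0) hc w hw
      (localNonsplitCongr (IsCMField.complexConj L) hc w hw T isUnit_one h g)
    have e2 := mem_localIntegralLevel_iff_of_smul_eq (IsCMField.complexConj L) 3 H' hc w hw g
    refine (e1.trans ?_).trans e2.symm
    rw [localNonsplitEquiv_localNonsplitCongr]
    constructor
    · intro h'
      have h'' := Subgroup.mul_mem _ (Subgroup.mul_mem _ (Subgroup.inv_mem _ hT) h') hT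
      simpa only [mul_assoc, mul_inv_cancel_left, inv_mul_cancel, mul_one, inv_mul_cancel_left] using h''
    · intro h'
      exact Subgroup.mul_mem _ (Subgroup.mul_mem _ hT h') (Subgroup.inv_mem _ hT)
  · -- conjugacy in `GL₃(∏ L_{w′})` from the one-component conjugacy
    refine isConj_of_isConj_mulEquiv'
      ((localGLPiEquiv L 3 v).toMulEquiv.trans (localGLPiEvalEquiv (IsCMField.complexConj L) 3 hc w hw).toMulEquiv) ?_
    show IsConj
      ((localNonsplitEquiv (IsCMField.complexConj L) H' hc w hw g :
        unitaryGroupOfForm (galAdicCompletionMap (L := L) (IsCMField.complexConj L) hw) (placeForm H' w.1)) :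
        GL (Fin 3) (w.1.adicCompletion L))
      ((localNonsplitEquiv (IsCMField.complexConj L)
        (Matrix.of fun i j : Fin 3 => if i.val + j.val + 1 = 3 then (1 : L) else 0) hc w hw
          (localNonsplitCongr (IsCMField.complexConj L) hc w hw T isUnit_one h g) :
        unitaryGroupOfForm (galAdicCompletionMap (L := L) (IsCMField.complexConj L) hw)
          (placeForm (Matrix.of fun i j : Fin 3 => if i.val + j.val + 1 = 3 then (1 : L) else 0) w.1)) :
        GL (Fin 3) (w.1.adicCompletion L))
    rw [localNonsplitEquiv_localNonsplitCongr]
    exact isConj_iff.2 ⟨T, rfl⟩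

set_option maxHeartbeats 1600000 in
-- instance-term unification on the CM local carriers (as in ★ `lintegral_conj_cmBorel_eq_mul_lintegral_mul`); < 60 s
/-- **THE UNIT ORBITAL INTEGRAL OF THE INNER FORM AT A SPLIT-TORUS CLASS, NON-SPLIT PLACE** (the `G`-side of [Rogawski1990] Prop. 4.9.1 (b) in
the Levi case, (4.9.2) «`Φ(γ, 1_K) = |D(γ)|⁻¹(1_K)^{(B)}(γ)`», with the compatible measures of §4.3).  At a finite place `v` of `L⁺` non-split
and unramified in `L`, of good reduction for the hermitian `H′`: for a canonical orbital measure family `mG` on `U(H′)(L⁺_v)` (predicate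
`IsRegularElt`, Haar `νG` with `νG(K′) = 1`) and a REGULAR INTEGRAL diagonal `t = diag(d) ∈ T(𝒪_v) ≤ U(Φ₃)(L⁺_v)` (`dᵢ − dⱼ` units), there is
`γ₀ ∈ K′ = U(H′)(𝒪_v)`, `GL₃(∏ L_w)`-conjugate to `t` (hence matching every `γ_H` with `ι_v γ_H = t`), whose unit orbital integral is
**`Φ(⟦γ₀⟧, 1_{K′}) = (‖d₀⁻¹d₁ − 1‖ · χ⁻(d₀⁻¹d₂ − 1))⁻¹`** — ★ A-p12's twist module `J_G(t)` (`UnitaryGroupHeisenbergRingRegularTwist`),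
through ψ : U(H′)_v ≃ U(Φ₃)_v (`exists_continuousMulEquiv_level_isConj_of_nonsplit`), ★ `TorusOrbitalDescentUnitCanonical` §2, ★ B-p12
`exists_measure_quotient_torusU_cmLocal_eq_smul_map`, `Z(t) = T` and `compactCore T ⊆ K` (★ `RegularDiagonalCentralizer`).
[cite: Rogawski1990, §4.9 Prop. 4.9.1 (b), (4.9.2) p. 55; §4.3 (4.3.1) p. 43; §14.2 p. 233] [cite: DeitmarEchterhoff2014, Thm. 1.5.3] -/
theorem exists_classOrbitalIntegral_indicator_eq_twist_of_torus_regular_of_nonsplit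
    (L : Type) [Field L] [NumberField L] [IsCMField L] (H' : Matrix (Fin 3) (Fin 3) L)
    (hH' : (H'.map (IsCMField.complexConj L))ᵀ = H') (hH'd : IsUnit H'.det)
    {v : HeightOneSpectrum (𝓞 ↥(maximalRealSubfield L))} (w : PlacesOver L v)
    (hw : IsCMField.complexConj L • w.1 = w.1) (hv : Algebra.IsUnramifiedIn (𝓞 L) v.asIdeal)
    (hH'w : IsUnit (placeForm H' w.1)) (hH'i : hH'w.unit ∈ glInt 3 (w.1.adicCompletion L))
    [MeasurableSpace ((cmDatum L 3 H').Local v)] [BorelSpace ((cmDatum L 3 H').Local v)]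
    [∀ γ : (cmDatum L 3 H').Local v, MeasurableSpace (((cmDatum L 3 H').Local v) ⧸ Subgroup.centralizer ({γ} : Set ((cmDatum L 3 H').Local v)))]
    [∀ γ : (cmDatum L 3 H').Local v, BorelSpace (((cmDatum L 3 H').Local v) ⧸ Subgroup.centralizer ({γ} : Set ((cmDatum L 3 H').Local v)))]
    (νG : Measure ((cmDatum L 3 H').Local v)) [νG.IsHaarMeasure] [νG.IsMulRightInvariant]
    {mG : OrbitalMeasureFamily ((cmDatum L 3 H').Local v)}
    (hmG : mG.IsCanonical (fun γ => IsRegularElt (γ.val : GL (Fin 3) (LocalRing L v))) νG)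
    (hνG : νG (cmLocalIntegralLevel L 3 H' v : Set ((cmDatum L 3 H').Local v)) = 1)
    (t : ↥(torusU (conjLocal L (IsCMField.complexConj L) v) (cmLocalForm L 3 v))) {d : Fin 3 → (LocalRing L v)ˣ}
    (hd : glDiagonal 3 (LocalRing L v) d =
      ((t : ↥(unitaryGroupOfForm (conjLocal L (IsCMField.complexConj L) v) (cmLocalForm L 3 v))) : GL (Fin 3) (LocalRing L v)))
    (hreg : ∀ i j, i ≠ j → IsUnit ((d i : LocalRing L v) - d j))
    (htreg : IsRegularElt ((t : ↥(unitaryGroupOfForm (conjLocal L (IsCMField.complexConj L) v) (cmLocalForm L 3 v))) : GL (Fin 3) (LocalRing L v)))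
    (ha : IsUnit ((((d 0)⁻¹ * d 1 : (LocalRing L v)ˣ) : LocalRing L v) - 1))
    (hb : IsUnit ((((d 0)⁻¹ * d 2 : (LocalRing L v)ˣ) : LocalRing L v) - 1))
    (htK : (t : ↥(unitaryGroupOfForm (conjLocal L (IsCMField.complexConj L) v) (cmLocalForm L 3 v))) ∈
      cmLocalIntegralLevel L 3 (Matrix.of fun i j : Fin 3 => if i.val + j.val + 1 = 3 then (1 : L) else 0) v) :
    ∃ γ₀ : (cmDatum L 3 H').Local v, γ₀ ∈ cmLocalIntegralLevel L 3 H' v ∧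
      IsConj (((t : ↥(unitaryGroupOfForm (conjLocal L (IsCMField.complexConj L) v) (cmLocalForm L 3 v))) : GL (Fin 3) (LocalRing L v)))
        (γ₀.val : GL (Fin 3) (LocalRing L v)) ∧
      classOrbitalIntegral mG ((cmLocalIntegralLevel L 3 H' v : Set ((cmDatum L 3 H').Local v)).indicator fun _ => (1 : ℂ))
          (ConjClasses.mk γ₀) =
        (((letI : MeasurableSpace (LocalRing L v) := borel _; haveI : BorelSpace (LocalRing L v) := ⟨rfl⟩
          haveI : SecondCountableTopology (LocalRing L v) := secondCountableTopology_localRing (E := L) v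
          ((distribHaarChar (LocalRing L v) ha.unit)⁻¹ *
            (HeisRing.skewModulus (conjLocal L (IsCMField.complexConj L) v) (continuous_conjLocal L (IsCMField.complexConj L) v) hb.unit
              (HeisRing.map_unit_torusCentralScalar_sub_one (conjLocal L (IsCMField.complexConj L) v) (cmLocalForm_eq_over L 3 v) t hd hb))⁻¹ :
                ℝ≥0)) : ℝ) : ℂ) := by
  have hc := IsCMField.complexConj_ne_one L
  haveI : Algebra.IsQuadraticExtension ↥(maximalRealSubfield L) L := IsCMField.isQuadraticExtension L
  -- Step 1: the comparison `ψ`, the match `γ₀ := ψ⁻¹ t`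
  obtain ⟨ψ, hlev, hconjψ, -⟩ := exists_continuousMulEquiv_level_isConj_of_nonsplit L H' hH' w hw hv hH'w hH'i
  set G3 := ↥(unitaryGroupOfForm (conjLocal L (IsCMField.complexConj L) v) (cmLocalForm L 3 v)) with hG3
  set t' : ↥(unitaryGroupOfForm (conjLocal L (IsCMField.complexConj L) v) (cmLocalForm L 3 v)) :=
    (t : ↥(unitaryGroupOfForm (conjLocal L (IsCMField.complexConj L) v) (cmLocalForm L 3 v))) with ht'
  set γ₀ : (cmDatum L 3 H').Local v := ψ.symm t' with hγ₀
  have hψγ : ψ γ₀ = t' := ψ.apply_symm_apply t'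
  have hψγ' : ψ.toMulEquiv γ₀ = t' := hψγ
  have hγ₀K : γ₀ ∈ cmLocalIntegralLevel L 3 H' v := (hlev γ₀).1 (hψγ ▸ htK)
  have hconj : IsConj ((t' : GL (Fin 3) (LocalRing L v))) (γ₀.val : GL (Fin 3) (LocalRing L v)) := by
    have h1 := hconjψ γ₀
    rw [hψγ] at h1
    exact h1.symm
  have hreg₀ : IsRegularElt (γ₀.val : GL (Fin 3) (LocalRing L v)) := isRegularElt_of_isConj hconj htreg
  refine ⟨γ₀, hγ₀K, hconj, ?_⟩
  -- Step 2: the canonical measure at `γ₀`; the class orbital integral as a `lintegral`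
  letI : MeasurableSpace («local» L (IsCMField.complexConj L) 3 H' v) := ‹MeasurableSpace ((cmDatum L 3 H').Local v)›
  haveI : BorelSpace («local» L (IsCMField.complexConj L) 3 H' v) := ‹BorelSpace ((cmDatum L 3 H').Local v)›
  obtain ⟨tZ, htZ, htZi, htZ1⟩ : ∃ t : Measure ↥(Subgroup.centralizer ({γ₀} : Set ((cmDatum L 3 H').Local v))),
      t.IsHaarMeasure ∧ t.IsInvInvariant ∧ t (compactCore (↥(Subgroup.centralizer ({γ₀} : Set ((cmDatum L 3 H').Local v))))) = 1 :=
    forall_isRegularElt_exists_isHaarMeasure_compactCore_centralizer_local_eq_one (IsCMField.complexConj L) 3 H' hc hH' hH'd γ₀ hreg₀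
  haveI := htZ
  haveI := htZi
  have hP : ∀ g x : (cmDatum L 3 H').Local v, IsRegularElt (g.val : GL (Fin 3) (LocalRing L v)) →
      IsRegularElt ((x * g * x⁻¹).val : GL (Fin 3) (LocalRing L v)) := fun g x hg =>
    (Literature.NumberTheory.Rogawski1990.isRegularElt_conj_iff (x.val : GL (Fin 3) (LocalRing L v)) (g.val : GL (Fin 3) (LocalRing L v))).2 hg
  have hK'co := isCompact_isOpen_cmLocalIntegralLevel L 3 H' v
  rw [hmG.classOrbitalIntegral_mk_eq_orbitalIntegral' hP hreg₀ tZ htZ1,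
    orbitalIntegral_indicator_complex_eq_ofReal γ₀ (cmLocalIntegralLevel L 3 H' v),
    orbitalIntegral_indicator_eq_toReal_lintegral γ₀ (cmLocalIntegralLevel L 3 H' v) hK'co.2]
  -- Step 3: structure on `G₃ = U(Φ₃)(L⁺_v)` and the transported measures
  letI mG3 : MeasurableSpace G3 := borel _
  haveI : BorelSpace G3 := ⟨rfl⟩
  haveI : LocallyCompactSpace G3 := locallyCompactSpace_local (IsCMField.complexConj L) 3 _ v
  haveI : SecondCountableTopology G3 := secondCountableTopology_local (IsCMField.complexConj L) 3 _ v
  letI mQ : MeasurableSpace (G3 ⧸ torusU (conjLocal L (IsCMField.complexConj L) v) (cmLocalForm L 3 v)) := borel _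
  haveI : BorelSpace (G3 ⧸ torusU (conjLocal L (IsCMField.complexConj L) v) (cmLocalForm L 3 v)) := ⟨rfl⟩
  -- `Ψ Z(γ₀) = T`
  have hZT : ∀ g : (cmDatum L 3 H').Local v, ψ.toMulEquiv g ∈ torusU (conjLocal L (IsCMField.complexConj L) v) (cmLocalForm L 3 v) ↔
      g ∈ Subgroup.centralizer ({γ₀} : Set ((cmDatum L 3 H').Local v)) := by
    intro g
    rw [mem_torusU_iff_mem_centralizer_of_isUnit_sub hd hreg, Subgroup.mem_centralizer_singleton_iff,
      Subgroup.mem_centralizer_singleton_iff, ← hψγ]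
    change ψ g * ψ γ₀ = ψ γ₀ * ψ g ↔ g * γ₀ = γ₀ * g
    rw [← map_mul, ← map_mul, ψ.injective.eq_iff]
  -- the transported Haar measures
  obtain ⟨ν, hν⟩ : ∃ ν : Measure G3, ν = Measure.map ψ.toMulEquiv νG := ⟨_, rfl⟩
  haveI : ν.IsHaarMeasure := by rw [hν]; exact MulEquiv.isHaarMeasure_map νG ψ.toMulEquiv ψ.continuous ψ.symm.continuous
  haveI : ν.IsMulRightInvariant := by
    rw [hν]; exact isMulRightInvariant_map_mulEquiv_of_isMulRightInvariant ψ.toMulEquiv ψ.continuous.measurable νG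
  haveI hZc : IsClosed ((Subgroup.centralizer ({γ₀} : Set ((cmDatum L 3 H').Local v)) : Subgroup ((cmDatum L 3 H').Local v)) :
      Set ((cmDatum L 3 H').Local v)) := isClosed_coe_centralizer_singleton γ₀
  have hT : IsClosed ((torusU (conjLocal L (IsCMField.complexConj L) v) (cmLocalForm L 3 v) : Subgroup G3) : Set G3) :=
    isClosed_cmBorelTriple_M L v
  haveI : LocallyCompactSpace ↥(Subgroup.centralizer ({γ₀} : Set ((cmDatum L 3 H').Local v))) :=
    hZc.isClosedEmbedding_subtypeVal.locallyCompactSpace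
  haveI : SecondCountableTopology ↥(Subgroup.centralizer ({γ₀} : Set ((cmDatum L 3 H').Local v))) :=
    TopologicalSpace.Subtype.secondCountableTopology _
  haveI : LocallyCompactSpace ↥(torusU (conjLocal L (IsCMField.complexConj L) v) (cmLocalForm L 3 v)) :=
    hT.isClosedEmbedding_subtypeVal.locallyCompactSpace
  haveI : SecondCountableTopology ↥(torusU (conjLocal L (IsCMField.complexConj L) v) (cmLocalForm L 3 v)) :=
    TopologicalSpace.Subtype.secondCountableTopology _
  let eH := subgroupCongrHomeomorph ψ.toMulEquiv (Subgroup.centralizer ({γ₀} : Set ((cmDatum L 3 H').Local v)))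
    (torusU (conjLocal L (IsCMField.complexConj L) v) (cmLocalForm L 3 v)) hZT ψ.continuous ψ.symm.continuous
  let eZ : ↥(Subgroup.centralizer ({γ₀} : Set ((cmDatum L 3 H').Local v))) ≃ₜ*
      ↥(torusU (conjLocal L (IsCMField.complexConj L) v) (cmLocalForm L 3 v)) :=
    { toMulEquiv :=
        { toEquiv := eH.toEquiv
          map_mul' := fun a b => Subtype.ext (map_mul ψ (a : (cmDatum L 3 H').Local v) (b : (cmDatum L 3 H').Local v)) }
      continuous_toFun := eH.continuous
      continuous_invFun := eH.symm.continuous }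
  have heZ : (eZ : _ → ↥(torusU (conjLocal L (IsCMField.complexConj L) v) (cmLocalForm L 3 v))) = eH := rfl
  obtain ⟨tT, htT⟩ : ∃ tT : Measure ↥(torusU (conjLocal L (IsCMField.complexConj L) v) (cmLocalForm L 3 v)), tT = Measure.map eH tZ :=
    ⟨_, rfl⟩
  haveI : tT.IsHaarMeasure := by
    rw [htT, ← heZ]; exact MulEquiv.isHaarMeasure_map tZ eZ.toMulEquiv eZ.continuous eZ.symm.continuous
  haveI : tT.IsInvInvariant := by
    rw [htT, ← heZ]; exact isInvInvariant_map_mulEquiv eZ.toMulEquiv eZ.continuous.measurable tZ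
  -- Step 4: the level `K₃`, Haar measures on `K₃`, `N`, `T`, and the Iwasawa form of `ν∕t_T`
  obtain ⟨K3, hK3⟩ : ∃ K3 : Subgroup G3,
      K3 = cmLocalIntegralLevel L 3 (Matrix.of fun i j : Fin 3 => if i.val + j.val + 1 = 3 then (1 : L) else 0) v := ⟨_, rfl⟩
  have hK3co : IsCompact (K3 : Set G3) ∧ IsOpen (K3 : Set G3) := by
    rw [hK3]; exact isCompact_isOpen_cmLocalIntegralLevel L 3 (Matrix.of fun i j : Fin 3 => if i.val + j.val + 1 = 3 then (1 : L) else 0) v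
  haveI : LocallyCompactSpace ↥K3 := hK3co.1.isClosed.isClosedEmbedding_subtypeVal.locallyCompactSpace
  haveI : LocallyCompactSpace ↥(unipotentU (conjLocal L (IsCMField.complexConj L) v) (cmLocalForm L 3 v)) :=
    (isClosed_cmBorelTriple_N L v).isClosedEmbedding_subtypeVal.locallyCompactSpace
  haveI : SecondCountableTopology ↥(unipotentU (conjLocal L (IsCMField.complexConj L) v) (cmLocalForm L 3 v)) :=
    TopologicalSpace.Subtype.secondCountableTopology _
  obtain ⟨κ, hκ⟩ : ∃ κ : Measure ↥K3, κ.IsHaarMeasure := ⟨Measure.haar, inferInstance⟩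
  obtain ⟨μN, hμN⟩ : ∃ μN : Measure ↥(unipotentU (conjLocal L (IsCMField.complexConj L) v) (cmLocalForm L 3 v)), μN.IsHaarMeasure :=
    ⟨Measure.haar, inferInstance⟩
  obtain ⟨α, hα⟩ : ∃ α : Measure ↥(torusU (conjLocal L (IsCMField.complexConj L) v) (cmLocalForm L 3 v)), α.IsHaarMeasure :=
    ⟨Measure.haar, inferInstance⟩
  haveI : SMulInvariantMeasure G3 (G3 ⧸ torusU (conjLocal L (IsCMField.complexConj L) v) (cmLocalForm L 3 v))
      (quotientMeasure (torusU (conjLocal L (IsCMField.complexConj L) v) (cmLocalForm L 3 v)) tT hT ν) :=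
    smulInvariantMeasure_quotientMeasure _ tT hT ν
  have hμ0 : quotientMeasure (torusU (conjLocal L (IsCMField.complexConj L) v) (cmLocalForm L 3 v)) tT hT ν ≠ 0 :=
    quotientMeasure_ne_zero _ tT hT ν
  have hKB : ∀ g : G3, ∃ k ∈ K3, ∃ b ∈ borelU (conjLocal L (IsCMField.complexConj L) v) (cmLocalForm L 3 v), g = k * b := fun g => by
    obtain ⟨k, hk, b, hb⟩ := exists_mem_cmLocalIntegralLevel_mul_borel L 3 v g
    exact ⟨k, by rw [hK3]; exact hk, b.1, b.2, hb⟩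
  obtain ⟨C, -, hμC⟩ := exists_measure_quotient_torusU_cmLocal_eq_smul_map L v hK3co.1 hKB κ α μN
    (quotientMeasure (torusU (conjLocal L (IsCMField.complexConj L) v) (cmLocalForm L 3 v)) tT hT ν) hμ0
  -- Step 5: the two normalisations `ν(K₃) = 1`, `t_T(T ∩ K₃) = 1`
  have hK' : ∀ g : (cmDatum L 3 H').Local v, g ∈ cmLocalIntegralLevel L 3 H' v ↔ ψ.toMulEquiv g ∈ K3 := fun g => by
    rw [hK3]; exact (hlev g).symm
  have hψm : Measurable (ψ.toMulEquiv : (cmDatum L 3 H').Local v → G3) := ψ.continuous.measurable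
  have hν1 : ν K3 = 1 := by
    rw [hν, Measure.map_apply hψm hK3co.2.measurableSet]
    have hpre : (ψ.toMulEquiv : (cmDatum L 3 H').Local v → G3) ⁻¹' (K3 : Set G3) = (cmLocalIntegralLevel L 3 H' v : Set ((cmDatum L 3 H').Local v)) := by
      ext g; exact (hK' g).symm
    rw [hpre, hνG]
  -- the `w`-component of `t` is the regular diagonal `diag(d_w)`
  have hγmat : (((localNonsplitEquiv (IsCMField.complexConj L) (Matrix.of fun i j : Fin 3 => if i.val + j.val + 1 = 3 then (1 : L) else 0)
        hc w hw (ψ.toMulEquiv γ₀) : ↥(unitaryGroupOfForm (galAdicCompletionMap (L := L) (IsCMField.complexConj L) hw)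
          (placeForm (Matrix.of fun i j : Fin 3 => if i.val + j.val + 1 = 3 then (1 : L) else 0) w.1))) :
        GL (Fin 3) (w.1.adicCompletion L)) : Matrix (Fin 3) (Fin 3) (w.1.adicCompletion L)) =
      Matrix.diagonal fun i => ((d i : (LocalRing L v)ˣ) : LocalRing L v) w := by
    rw [coe_coe_localNonsplitEquiv_apply, hψγ', ← hd, coe_glDiagonal,
      Matrix.diagonal_map (RingHom.map_zero (Pi.evalRingHom (fun w' : PlacesOver L v => w'.1.adicCompletion L) w))]
    rfl
  have hdw : ∀ i j : Fin 3, i ≠ j → IsUnit (((d i : (LocalRing L v)ˣ) : LocalRing L v) w - ((d j : (LocalRing L v)ˣ) : LocalRing L v) w) := by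
    intro i j hij
    have h1 := (hreg i j hij).map (Pi.evalRingHom (fun w' : PlacesOver L v => w'.1.adicCompletion L) w)
    rwa [map_sub] at h1
  have hcore : compactCore ↥(Subgroup.centralizer ({γ₀} : Set ((cmDatum L 3 H').Local v))) ⊆
      Subtype.val ⁻¹' (cmLocalIntegralLevel L 3 H' v : Set ((cmDatum L 3 H').Local v)) := by
    -- read in `GL₃(L_w)` through `ψ` and the one-place model of `U(Φ₃)`
    refine compactCore_centralizer_subset_of_hom 3 (w.1)
      ((unitaryGroupOfForm (galAdicCompletionMap (L := L) (IsCMField.complexConj L) hw)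
          (placeForm (Matrix.of fun i j : Fin 3 => if i.val + j.val + 1 = 3 then (1 : L) else 0) w.1)).subtype.comp
        ((localNonsplitEquiv (IsCMField.complexConj L) (Matrix.of fun i j : Fin 3 => if i.val + j.val + 1 = 3 then (1 : L) else 0)
          hc w hw).toMulEquiv.toMonoidHom.comp ψ.toMulEquiv.toMonoidHom))
      (continuous_subtype_val.comp ((localNonsplitEquiv (IsCMField.complexConj L)
        (Matrix.of fun i j : Fin 3 => if i.val + j.val + 1 = 3 then (1 : L) else 0) hc w hw).continuous.comp ψ.continuous))
      (cmLocalIntegralLevel L 3 H' v) (fun g => ?_) γ₀ _ rfl ?_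
    · exact (hlev g).symm.trans (mem_localIntegralLevel_iff_of_smul_eq (IsCMField.complexConj L) 3 _ hc w hw (ψ g))
    · intro C' hC' hC'Z
      exact subgroup_le_glInt_of_isCompact_of_le_centralizer_diagonal 3 (w.1) hγmat hdw C' hC' hC'Z
  have htK1 : tT (Subtype.val ⁻¹' (K3 : Set G3)) = 1 := by
    rw [htT, Measure.map_apply eH.continuous.measurable (hK3co.2.preimage continuous_subtype_val).measurableSet]
    have hpre : (eH : _ → ↥(torusU (conjLocal L (IsCMField.complexConj L) v) (cmLocalForm L 3 v))) ⁻¹' (Subtype.val ⁻¹' (K3 : Set G3)) =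
        Subtype.val ⁻¹' (cmLocalIntegralLevel L 3 H' v : Set ((cmDatum L 3 H').Local v)) := by
      ext z
      simp only [Set.mem_preimage]
      exact (hK' (z : (cmDatum L 3 H').Local v)).symm
    rw [hpre]
    exact measure_preimage_eq_one_of_compactCore_subset _ tZ htZ1 (cmLocalIntegralLevel L 3 H' v) hK'co.1 hcore
  -- Step 6: the twist module (★ A-p12) and the transported torus descent (★ FILE B §2)
  have hTN : ∀ a ∈ torusU (conjLocal L (IsCMField.complexConj L) v) (cmLocalForm L 3 v),
      ∀ n ∈ unipotentU (conjLocal L (IsCMField.complexConj L) v) (cmLocalForm L 3 v),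
        a * n * a⁻¹ ∈ unipotentU (conjLocal L (IsCMField.complexConj L) v) (cmLocalForm L 3 v) :=
    fun a ha n hn => conj_mem_unipotentU_cmLocal L v ha hn
  have hKP : ∀ ⦃m u : G3⦄, m ∈ torusU (conjLocal L (IsCMField.complexConj L) v) (cmLocalForm L 3 v) →
      u ∈ unipotentU (conjLocal L (IsCMField.complexConj L) v) (cmLocalForm L 3 v) → m * u ∈ K3 → m ∈ K3 := by
    rw [hK3]; exact mem_cmLocalIntegralLevel_of_torus_mul_unipotent L 3 v
  have htT' : ψ.toMulEquiv γ₀ ∈ torusU (conjLocal L (IsCMField.complexConj L) v) (cmLocalForm L 3 v) := by rw [hψγ']; exact t.2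
  have ht' : ∀ a ∈ torusU (conjLocal L (IsCMField.complexConj L) v) (cmLocalForm L 3 v), a * ψ.toMulEquiv γ₀ = ψ.toMulEquiv γ₀ * a := by
    rw [hψγ']; exact forall_mem_torusU_cmLocal_comm L v t.2
  have hJac : ∀ Φ : G3 → ℝ≥0∞, Measurable Φ →
      ∫⁻ n, Φ ((n : G3) * ψ.toMulEquiv γ₀ * (n : G3)⁻¹) ∂μN =
        ((letI : MeasurableSpace (LocalRing L v) := borel _; haveI : BorelSpace (LocalRing L v) := ⟨rfl⟩
          haveI : SecondCountableTopology (LocalRing L v) := secondCountableTopology_localRing (E := L) v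
          ((distribHaarChar (LocalRing L v) ha.unit)⁻¹ *
            (HeisRing.skewModulus (conjLocal L (IsCMField.complexConj L) v) (continuous_conjLocal L (IsCMField.complexConj L) v) hb.unit
              (HeisRing.map_unit_torusCentralScalar_sub_one (conjLocal L (IsCMField.complexConj L) v) (cmLocalForm_eq_over L 3 v) t hd hb))⁻¹ :
                ℝ≥0)) : ℝ≥0∞) * ∫⁻ n, Φ (ψ.toMulEquiv γ₀ * (n : G3)) ∂μN := by
    intro Φ hΦ
    rw [hψγ']
    exact lintegral_conj_cmBorel_eq_mul_lintegral_mul L v μN t hd ha hb Φ hΦ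
  have key := lintegral_descConj_centralizer_indicator_eq_of_mulEquiv (G := G3) hK3co.2 hT hTN hKP ν tT κ μN ψ.toMulEquiv
    ψ.continuous ψ.symm.continuous γ₀ hZT νG hν tZ htT (cmLocalIntegralLevel L 3 H' v) hK' hμC hν1 htK1 htT' ht' hJac
  rw [key, hψγ', Set.indicator_of_mem (show t' ∈ (K3 : Set G3) by rw [hK3]; exact htK), Pi.one_apply, mul_one,
    ENNReal.coe_toReal]

end Literature.NumberTheory.Automorphic.UnitaryGroup

end
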